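import Summits.BirchSwinnertonDyer.Rank1Residual.X4.LevelLoweringCharacter
import Mathlib.RingTheory.Artinian.Module
import HarnessLib

/-!
# The dual action of `𝕋_ℤ` on `Hom(H₁(X₀(M), ℤ), k)`: transport to level `Mℓ`, finiteness, Fitting pieces (cell `b2b-bsdres`, seat additive-p4, line V45 (P1), part 1/2)

HONEST FRAMING (verbatim, cell `b2b-bsdres`): the goal of the cell is to DELETE the COMBINATION-SHAPED
residual classes for ALL analytic-rank `≤ 1` curves over `ℚ` — "full BSD formula for every rank `≤ 1`
curve in class `C`" assembled STRICTLY from published theorems — so that the rank-`≤ 1` remainder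
becomes exactly the CONSTRUCTION-SHAPED classes, which are TYPED (missing-input Props), NOT attempted;
this is not "finishing BSD". This file: TOOL theorems (linear algebra over the period homology
`H₁(X₀(M), ℤ) = periodHomology M ⊆ S₂(Γ₀(M))^∨` and its `𝕋_ℤ`-submodule structure
`periodHomologyHecke M`), 0 defs, 0 facts, nothing booked; X4 CONSTRUCTION-SHAPED.

## What is proved (the pieces of the Fitting projection of `X4/OldEigenPairOfIhara`)

* §1 `exists_levelRaise` — TRANSPORT of `𝕋̃ = ℤ[T_r : r ∤ Mℓ]` (level `M`) to level `Mℓ` along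
  `α_*`, `β_*` and the eigenvalues of a `χ`-eigen additive `Φ` on `H₁(X₀(Mℓ), ℤ)`: for `s ∈ 𝕋̃` there
  is `t ∈ 𝕋_ℤ(Mℓ)` with `α_*(t z) = s α_* z`, `β_*(t z) = s β_* z`, `Φ(t z) = χ(s) Φ(z)` (generators
  `T_r ↦ T_r`, Diamond–Shurman Prop. 5.6.2; sums, products).
* §2 `finite_addMonoidHom_periodHomologyHecke` — `V = Hom(H₁(X₀(M), ℤ), k)` is finite-dimensional
  (`periodHomology_fg`, Cremona §2.1); `apply_smul_eq_mul_of_T` — eigen for the generators `T_q`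
  ⟹ eigen for all of `𝕋̃`.
* §3 for ANY `ρ : 𝕋_ℤ → End_k(V)` with `ρ(t)Λ = Λ∘(t • ·)` (hypothesis `hρ`; no definition is made):
  `ρ(t)ρ(t') = ρ(t't)`, powers, commutation; the one-component Fitting step
  `exists_mem_range_apply_eq_mul` (`V = ker ρ(s)ⁿ ⊕ im ρ(s)ⁿ` ⟹ `N ∈ im ρ(s)ⁿ` with
  `N(x) = c L(sⁿ • x)`); `ker ρ(s) ∩ im ρ(s)ⁿ = 0` (`eq_zero_of_mem_range_of_apply_eq_zero`); the
  `T`-defect of an `im`-element stays in `im` (`sub_smul_mem_range`).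

## References

* F. Diamond, J. Shurman, *A First Course in Modular Forms* (2005), Prop. 5.6.2. [cite: DiamondShurman2005, Prop. 5.6.2]
* H. Darmon, F. Diamond, R. Taylor, *Fermat's Last Theorem* (1995), §4.3 p. 119, Lemma 4.28. [cite: DarmonDiamondTaylor1995, §4.3 (p. 119) and Lemma 4.30]
* J. E. Cremona, *Algorithms for modular elliptic curves* (1997), §2.1. [cite: CremonaAlgorithms1997, §2.1 (2.1.1), Lemma 2.1.1]
-/

noncomputable section

open scoped MatrixGroups ModularForm

open CongruenceSubgroup Finset Matrix

open Literature.NumberTheory.EllipticCurves Literature.NumberTheory.EllipticCurves.ModularForms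
  Literature.NumberTheory.EllipticCurves.ModularForms.HidaCohomology

namespace Summit.BirchSwinnertonDyer.Rank1Residual.LevelLowering

/-! ### §1 Transport of `𝕋̃` to level `Mℓ` along `α_*`, `β_*` and the eigenvalues of `Φ` -/

section Transport

variable {k : Type*} [CommRing k] {M : ℕ} [NeZero M] {ℓ : ℕ} [Fact ℓ.Prime]

/-- **Transport of `𝕋̃` to level `Mℓ`.** For every `s ∈ 𝕋̃ = ℤ[T_r : r ∤ Mℓ]` (operators of level
`M`) there is `t ∈ 𝕋_ℤ(Mℓ)` with `α_*(t·z) = s·α_* z`, `β_*(t·z) = s·β_* z` (all `z`), and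
`Φ(t·z) = χ(s) Φ(z)` on `H₁(X₀(Mℓ), ℤ)` for every `Φ` additive there with `Φ(T_r·z) = χ(T_r) Φ(z)`
(`r ∤ Mℓ`): generators `T_r ↦ T_r` (Diamond–Shurman Prop. 5.6.2, the tree's `heckeT_degeneracyMap0`),
then sums and products. [cite: DiamondShurman2005, Prop. 5.6.2] -/
theorem exists_levelRaise (Φ : Module.Dual ℂ (CuspForm (Gamma0 (M * ℓ)) 2) → k)
    (χ : HeckeRing0.primeTo M 2 (M * ℓ) →+* k)
    (haddΦ : ∀ x ∈ periodHomology (M * ℓ), ∀ y ∈ periodHomology (M * ℓ), Φ (x + y) = Φ x + Φ y)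
    (hΦT : ∀ (r : ℕ) (hr : r.Prime) (hrS : ¬ r ∣ M * ℓ), ∀ z ∈ periodHomology (M * ℓ),
      Φ (HeckeRing0.T (M * ℓ) 2 r hr • z) = χ (HeckeRing0.primeTo.T M 2 (M * ℓ) hr hrS) * Φ z)
    (s : HeckeRing0 M 2) (hs : s ∈ HeckeRing0.primeTo M 2 (M * ℓ)) :
    ∃ t : HeckeRing0 (M * ℓ) 2,
      (∀ z, (degeneracyMap0 M (M * ℓ) 1 2).dualMap (t • z) =
        s • (degeneracyMap0 M (M * ℓ) 1 2).dualMap z) ∧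
      (∀ z, (degeneracyMap0 M (M * ℓ) ℓ 2).dualMap (t • z) =
        s • (degeneracyMap0 M (M * ℓ) ℓ 2).dualMap z) ∧
      ∀ z ∈ periodHomology (M * ℓ), Φ (t • z) = χ ⟨s, hs⟩ * Φ z := by
  have h1 : M * 1 ∣ M * ℓ := by rw [mul_one]; exact dvd_mul_right M ℓ
  have hℓ' : M * ℓ ∣ M * ℓ := dvd_rfl
  change s ∈ Algebra.adjoin ℤ _ at hs
  induction hs using Algebra.adjoin_induction with
  | mem x hx =>
    obtain ⟨r, hr, hrN, rfl⟩ := hx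
    exact ⟨HeckeRing0.T (M * ℓ) 2 r hr, fun z ↦ dualMap_degeneracyMap0_T_smul h1 hr hrN z,
      fun z ↦ dualMap_degeneracyMap0_T_smul hℓ' hr hrN z, fun z hz ↦ hΦT r hr hrN z hz⟩
  | algebraMap n =>
    refine ⟨algebraMap ℤ _ n, fun z ↦ ?_, fun z ↦ ?_, fun z hz ↦ ?_⟩
    · rw [Algebra.algebraMap_eq_smul_one, Algebra.algebraMap_eq_smul_one, smul_assoc, one_smul,
        map_zsmul, smul_assoc, one_smul]
    · rw [Algebra.algebraMap_eq_smul_one, Algebra.algebraMap_eq_smul_one, smul_assoc, one_smul,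
        map_zsmul, smul_assoc, one_smul]
    · have e : (⟨algebraMap ℤ (HeckeRing0 M 2) n, Subalgebra.algebraMap_mem _ n⟩ :
          HeckeRing0.primeTo M 2 (M * ℓ)) = algebraMap ℤ _ n := rfl
      rw [e, eq_intCast (algebraMap ℤ (HeckeRing0.primeTo M 2 (M * ℓ))) n, map_intCast,
        eq_intCast, apply_intCast_smul_of_additive Φ haddΦ hz]
  | add x y hx' hy' hx hy =>
    obtain ⟨t₁, ha₁, hb₁, hΦ₁⟩ := hx
    obtain ⟨t₂, ha₂, hb₂, hΦ₂⟩ := hy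
    refine ⟨t₁ + t₂, fun z ↦ ?_, fun z ↦ ?_, fun z hz ↦ ?_⟩
    · rw [add_smul, map_add, ha₁, ha₂, add_smul]
    · rw [add_smul, map_add, hb₁, hb₂, add_smul]
    · rw [add_smul, haddΦ _ (HeckeRing0.smul_mem_periodHomology _ t₁ hz) _
        (HeckeRing0.smul_mem_periodHomology _ t₂ hz), hΦ₁ z hz, hΦ₂ z hz,
        show (⟨x + y, Subalgebra.add_mem _ hx' hy'⟩ : HeckeRing0.primeTo M 2 (M * ℓ)) =
          ⟨x, hx'⟩ + ⟨y, hy'⟩ from rfl, map_add]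
      ring
  | mul x y hx' hy' hx hy =>
    obtain ⟨t₁, ha₁, hb₁, hΦ₁⟩ := hx
    obtain ⟨t₂, ha₂, hb₂, hΦ₂⟩ := hy
    refine ⟨t₁ * t₂, fun z ↦ ?_, fun z ↦ ?_, fun z hz ↦ ?_⟩
    · rw [mul_smul, ha₁, ha₂, smul_smul]
    · rw [mul_smul, hb₁, hb₂, smul_smul]
    · rw [mul_smul, hΦ₁ _ (HeckeRing0.smul_mem_periodHomology _ t₂ hz), hΦ₂ z hz,
        show (⟨x * y, Subalgebra.mul_mem _ hx' hy'⟩ : HeckeRing0.primeTo M 2 (M * ℓ)) =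
          ⟨x, hx'⟩ * ⟨y, hy'⟩ from rfl, map_mul]
      ring

end Transport

/-! ### §2 The `k`-space `V = Hom(H₁(X₀(M), ℤ), k)`: finite-dimensional; eigen from generators -/

section Space

variable {k : Type*} {M : ℕ} [NeZero M]

/-- **`Hom(H₁(X₀(M), ℤ), k)` is a finite-dimensional `k`-space** (`k` a field): `H₁(X₀(M), ℤ)` is a finitely
generated abelian group (the tree's `periodHomology_fg`, Cremona 1997 §2.1), and an additive map is
determined by its values on generators. [cite: CremonaAlgorithms1997, §2.1 (2.1.1), Lemma 2.1.1] -/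
theorem finite_addMonoidHom_periodHomologyHecke [Field k] :
    Module.Finite k (↥(periodHomologyHecke M) →+ k) := by
  classical
  obtain ⟨g, hg⟩ := (periodHomology_fg (N := M))
  have hmem : ∀ i : g, (i : Module.Dual ℂ (CuspForm (Gamma0 M) 2)) ∈ periodHomologyHecke M := fun i ↦ by
    change (i : Module.Dual ℂ (CuspForm (Gamma0 M) 2)) ∈ periodHomology M
    rw [← hg]; exact AddSubgroup.subset_closure i.2
  let ev : (↥(periodHomologyHecke M) →+ k) →ₗ[k] (g → k) :=
    { toFun := fun Λ i ↦ Λ ⟨i, hmem i⟩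
      map_add' := fun Λ Λ' ↦ by ext i; rfl
      map_smul' := fun c Λ ↦ by ext i; rfl }
  refine Module.Finite.of_injective ev fun Λ Λ' hΛ ↦ ?_
  -- two additive maps agreeing on the generators agree
  have key : ∀ (x : Module.Dual ℂ (CuspForm (Gamma0 M) 2))
      (hx : x ∈ AddSubgroup.closure (g : Set (Module.Dual ℂ (CuspForm (Gamma0 M) 2)))),
      ∀ hx' : x ∈ periodHomologyHecke M, Λ ⟨x, hx'⟩ = Λ' ⟨x, hx'⟩ := by
    intro x hx
    induction hx using AddSubgroup.closure_induction with
    | mem y hy =>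
      intro hy'
      exact congr_fun hΛ ⟨y, hy⟩
    | zero => intro h0; exact (map_zero Λ).trans (map_zero Λ').symm
    | add x y hx hy ihx ihy =>
      intro hxy
      have hxP : x ∈ periodHomologyHecke M := by
        change x ∈ periodHomology M; rw [← hg]; exact hx
      have hyP : y ∈ periodHomologyHecke M := by
        change y ∈ periodHomology M; rw [← hg]; exact hy
      have e : (⟨x + y, hxy⟩ : ↥(periodHomologyHecke M)) = ⟨x, hxP⟩ + ⟨y, hyP⟩ := rfl
      rw [e, map_add, map_add, ihx hxP, ihy hyP]
    | neg x hx ihx =>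
      intro hxn
      have hxP : x ∈ periodHomologyHecke M := by
        change x ∈ periodHomology M; rw [← hg]; exact hx
      have e : (⟨-x, hxn⟩ : ↥(periodHomologyHecke M)) = -⟨x, hxP⟩ := rfl
      rw [e, map_neg, map_neg, ihx hxP]
  ext ⟨x, hx⟩
  have hx' : x ∈ AddSubgroup.closure (g : Set (Module.Dual ℂ (CuspForm (Gamma0 M) 2))) := by
    rw [hg]; exact hx
  exact key x hx' hx

variable {ℓ : ℕ}

/-- **Eigen for the generators `T_q` (`q ∤ Mℓ`) ⟹ eigen for all of `𝕋̃ = ℤ[T_q : q ∤ Mℓ]`** on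
`V = Hom(H₁(X₀(M), ℤ), k)` (sums and products of eigen-operators; the integers act as integers).
[cite: DarmonDiamondTaylor1995, §4.3 (p. 119) and Lemma 4.30] -/
theorem apply_smul_eq_mul_of_T [CommRing k] (N : ↥(periodHomologyHecke M) →+ k)
    (χ : HeckeRing0.primeTo M 2 (M * ℓ) →+* k)
    (hgen : ∀ (q : ℕ) (hq : q.Prime) (hqS : ¬ q ∣ M * ℓ) (x : ↥(periodHomologyHecke M)),
      N (HeckeRing0.T M 2 q hq • x) = χ (HeckeRing0.primeTo.T M 2 (M * ℓ) hq hqS) * N x)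
    (s : HeckeRing0 M 2) (hs : s ∈ HeckeRing0.primeTo M 2 (M * ℓ)) (x : ↥(periodHomologyHecke M)) :
    N (s • x) = χ ⟨s, hs⟩ * N x := by
  change s ∈ Algebra.adjoin ℤ _ at hs
  induction hs using Algebra.adjoin_induction generalizing x with
  | mem y hy =>
    obtain ⟨r, hr, hrN, rfl⟩ := hy
    exact hgen r hr hrN x
  | algebraMap n =>
    have e : (⟨algebraMap ℤ (HeckeRing0 M 2) n, Subalgebra.algebraMap_mem _ n⟩ :
        HeckeRing0.primeTo M 2 (M * ℓ)) = algebraMap ℤ _ n := rfl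
    rw [e, eq_intCast (algebraMap ℤ (HeckeRing0.primeTo M 2 (M * ℓ))) n, map_intCast,
      Algebra.algebraMap_eq_smul_one, smul_assoc, one_smul, map_zsmul, zsmul_eq_mul]
  | add y y' hy hy' ihy ihy' =>
    rw [show (⟨y + y', Subalgebra.add_mem _ hy hy'⟩ : HeckeRing0.primeTo M 2 (M * ℓ)) =
        ⟨y, hy⟩ + ⟨y', hy'⟩ from rfl, map_add, add_smul, map_add, ihy x, ihy' x]
    ring
  | mul y y' hy hy' ihy ihy' =>
    rw [show (⟨y * y', Subalgebra.mul_mem _ hy hy'⟩ : HeckeRing0.primeTo M 2 (M * ℓ)) =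
        ⟨y, hy⟩ * ⟨y', hy'⟩ from rfl, map_mul, mul_smul, ihy _, ihy' x]
    ring

end Space

/-! ### §3 The action `ρ(t)Λ = Λ∘(t • ·)` on `V = Hom(H₁(X₀(M), ℤ), k)`: small algebra -/

section Action

variable {k : Type*} [Field k] {M : ℕ} [NeZero M] {ℓ : ℕ} [Fact ℓ.Prime]

/-- `α_* z ∈ H₁(X₀(M), ℤ)` for `z ∈ H₁(X₀(Mℓ), ℤ)` (as a member of the `𝕋_ℤ`-submodule).
[cite: DarmonDiamondTaylor1995, Lemma 4.28 (p. 135)] -/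
theorem dualMap_degeneracyMap0_one_mem_periodHomologyHecke
    {z : Module.Dual ℂ (CuspForm (Gamma0 (M * ℓ)) 2)} (hz : z ∈ periodHomology (M * ℓ)) :
    (degeneracyMap0 M (M * ℓ) 1 2).dualMap z ∈ periodHomologyHecke M :=
  dualMap_degeneracyMap0_mem_periodHomology M (M * ℓ) 1
    (by rw [mul_one]; exact dvd_mul_right M ℓ) hz

/-- `β_* z ∈ H₁(X₀(M), ℤ)` for `z ∈ H₁(X₀(Mℓ), ℤ)` (as a member of the `𝕋_ℤ`-submodule).
[cite: DarmonDiamondTaylor1995, Lemma 4.28 (p. 135)] -/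
theorem dualMap_degeneracyMap0_self_mem_periodHomologyHecke
    {z : Module.Dual ℂ (CuspForm (Gamma0 (M * ℓ)) 2)} (hz : z ∈ periodHomology (M * ℓ)) :
    (degeneracyMap0 M (M * ℓ) ℓ 2).dualMap z ∈ periodHomologyHecke M :=
  dualMap_degeneracyMap0_mem_periodHomology M (M * ℓ) ℓ dvd_rfl hz

variable (ρ : HeckeRing0 M 2 → ((↥(periodHomologyHecke M) →+ k) →ₗ[k] (↥(periodHomologyHecke M) →+ k)))
  (hρ : ∀ (t : HeckeRing0 M 2) (Λ : ↥(periodHomologyHecke M) →+ k) (x : ↥(periodHomologyHecke M)),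
    ρ t Λ x = Λ (t • x))

include hρ

omit [Fact ℓ.Prime] in
/-- `ρ(t) ρ(t') = ρ(t' t)` for the action by precomposition. [folklore] -/
theorem precompAction_mul (t t' : HeckeRing0 M 2) : ρ t * ρ t' = ρ (t' * t) := by
  refine LinearMap.ext fun Λ ↦ AddMonoidHom.ext fun x ↦ ?_
  rw [Module.End.mul_apply, hρ, hρ, hρ, mul_smul]

omit [Fact ℓ.Prime] in
/-- `ρ(t)^m = ρ(t^m)`. [folklore] -/
theorem precompAction_pow (t : HeckeRing0 M 2) (m : ℕ) : ρ t ^ m = ρ (t ^ m) := by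
  induction m with
  | zero =>
    refine LinearMap.ext fun Λ ↦ AddMonoidHom.ext fun x ↦ ?_
    rw [pow_zero, pow_zero, Module.End.one_apply, hρ, one_smul]
  | succ m ih => rw [pow_succ, ih, precompAction_mul ρ hρ, ← pow_succ']

omit [Fact ℓ.Prime] in
/-- The `ρ(t)` commute (`𝕋_ℤ` is commutative). [folklore] -/
theorem precompAction_commute (t t' : HeckeRing0 M 2) : Commute (ρ t) (ρ t') := by
  change ρ t * ρ t' = ρ t' * ρ t
  rw [precompAction_mul ρ hρ, precompAction_mul ρ hρ, mul_comm]

omit [Fact ℓ.Prime] in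
/-- **Fitting, one component**: if `V = ker ρ(s)ⁿ ⊕ im ρ(s)ⁿ` then for every `L ∈ V` and scalar `c`
there is `N ∈ im ρ(s)ⁿ` with `N(x) = c · L(sⁿ • x)` — namely `N = c ρ(s)ⁿ I` for the `im`-component
`I` of `L`. [folklore] -/
theorem exists_mem_range_apply_eq_mul {s : HeckeRing0 M 2} {n : ℕ}
    (hn : IsCompl (LinearMap.ker (ρ s ^ n)) (LinearMap.range (ρ s ^ n))) (c : k)
    (L : ↥(periodHomologyHecke M) →+ k) :
    ∃ N : ↥(periodHomologyHecke M) →+ k, N ∈ LinearMap.range (ρ s ^ n) ∧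
      ∀ x : ↥(periodHomologyHecke M), N x = c * L ((s ^ n) • x) := by
  have htop : L ∈ LinearMap.ker (ρ s ^ n) ⊔ LinearMap.range (ρ s ^ n) := by
    rw [hn.sup_eq_top]; exact Submodule.mem_top
  obtain ⟨K, hK, I, hI, hKI⟩ := Submodule.mem_sup.mp htop
  refine ⟨c • (ρ s ^ n) I, Submodule.smul_mem _ c (LinearMap.mem_range_self _ I), fun x ↦ ?_⟩
  have e : (ρ s ^ n) L = (ρ s ^ n) I := by
    rw [← hKI, LinearMap.map_add, LinearMap.mem_ker.mp hK, zero_add]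
  rw [AddMonoidHom.smul_apply, smul_eq_mul, ← e, precompAction_pow ρ hρ, hρ]

omit [Fact ℓ.Prime] hρ in
/-- `ker ρ(s) ∩ im ρ(s)ⁿ = 0` when `V = ker ρ(s)ⁿ ⊕ im ρ(s)ⁿ` and `n ≥ 1`. [folklore] -/
theorem eq_zero_of_mem_range_of_apply_eq_zero {s : HeckeRing0 M 2} {n : ℕ}
    (hn : IsCompl (LinearMap.ker (ρ s ^ n)) (LinearMap.range (ρ s ^ n))) (hn1 : 1 ≤ n)
    {D : ↥(periodHomologyHecke M) →+ k} (hDr : D ∈ LinearMap.range (ρ s ^ n)) (hD : ρ s D = 0) :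
    D = 0 := by
  have hDk : D ∈ LinearMap.ker (ρ s ^ n) := by
    rw [LinearMap.mem_ker]
    obtain ⟨m, hm⟩ := Nat.exists_eq_add_of_le hn1
    rw [hm, add_comm, pow_succ, Module.End.mul_apply, hD, LinearMap.map_zero]
  have := hn.disjoint.le_bot (Submodule.mem_inf.mpr ⟨hDk, hDr⟩)
  simpa using this

omit [Fact ℓ.Prime] in
/-- The `T`-defect `ρ(T)N − θ N` of an element of `im ρ(s)ⁿ` lies in `im ρ(s)ⁿ` (commuting
operators). [folklore] -/
theorem sub_smul_mem_range {s : HeckeRing0 M 2} {n : ℕ} (T : HeckeRing0 M 2) (θ : k)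
    {N : ↥(periodHomologyHecke M) →+ k} (hN : N ∈ LinearMap.range (ρ s ^ n)) :
    ρ T N - θ • N ∈ LinearMap.range (ρ s ^ n) := by
  obtain ⟨G, hG⟩ := LinearMap.mem_range.mp hN
  have hc : Commute (ρ T) (ρ s ^ n) := (precompAction_commute ρ hρ _ _).pow_right n
  refine Submodule.sub_mem _ (LinearMap.mem_range.mpr ⟨ρ T G, ?_⟩) (Submodule.smul_mem _ θ hN)
  rw [← hG]
  exact (LinearMap.congr_fun hc.eq G).symm

end Action

end Summit.BirchSwinnertonDyer.Rank1Residual.LevelLowering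

end
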